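import Literature.NumberTheory.GelbartRogawski1991.LocalDoubledUnitarySiegel
import Literature.NumberTheory.Automorphic.UnitaryGroupNonsplitPlace
import Literature.NumberTheory.Automorphic.GLnCongruenceSubgroups
import HarnessLib

-- buildfix G11b-3 recipe (LEDGER B13-1/B13-3): elaborate sequentially so the trailing `attribute [implicit_reducible]`
-- block (reducibilityCoreExt is keyed to the async environment branch) is in force at `.olean` export.
set_option Elab.async false

/-!
# The unramified clause for the doubled unitary group, II: `det_Δ p ∈ 𝒪_w^×` and `χ_v(det_Δ p) = 1` on
# `P_Δ(F_v) ∩ H(𝒪_v)` ([GelbartRogawski1991, §3.1 (3.1.2)–(3.1.3)]; [Kudla1994, Thm 3.1])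

Topic `NumberTheory/GelbartRogawski1991`; namespace
`Literature.NumberTheory.GelbartRogawski1991.UnitaryDualPair.LocalSplitting` (sequel of `LocalDoubledUnitarySiegel`).
KERNEL only: proved lemmas; no named fact, no `sorry`.

Let `H = U(𝕍 ⊕ −𝕍)` be the doubled unitary group of the hermitian space `(E^n, T₀)`, `P_Δ ≤ H` its Siegel parabolic
(`IsSiegelDelta`) and `det_Δ p ∈ E_w` Kudla's `x(p)` at a place `w ∣ v` (`detDelta`, the determinant of the
`Δ`-block `p₁₁ + p₁₂` of `p_w`).  For `p ∈ P_Δ(F_v)` whose `w`-component lies in `GL_{n+n}(𝒪_w)` — in particular for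
`p ∈ P_Δ(F_v) ∩ H(𝒪_v)` (`UnitaryGroup.localInt`), at ANY finite place `v`, split or not — write the `e₂`-blocks of
`p_w` as `[[a, b], [c, d]]`; the Siegel condition is `a + b = c + d =: X` (tree `isSiegelDelta_iff_blocks`), and the
elementary column∕row operations `[[1, 0], [−1, 1]] · p_w · [[1, 0], [1, 1]] = [[X, b], [0, d − b]]` give
`det p_w = det X · det (d − b)` (`det_eq_of_blocks`) with BOTH factors integral.  Since `det p_w ∈ 𝒪_w^×`,
**`det_Δ p = det X` is a `w`-unit** (`valuation_detDelta_eq_one`).  Consequently, for a family `χ_v = (χ_w)_{w ∣ v}`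
of UNRAMIFIED characters (`χ_w = 1` on `𝒪_w^×`), **`χ_v(det_Δ p) = ∏_{w ∣ v} χ_w(det_Δ p_w) = 1`**
(`chiDet_eq_one_of_mem_localInt`; non-split form with the hypothesis at the one place `w`:
`chiDet_eq_one_of_mem_localInt_of_smul_eq`).  This is the parabolic half of the unramified clause of
[GelbartRogawski1991, §3.1 (3.1.3)] (the normalising character `p ↦ χ_v(det_Δ p)` of the local splitting
[Kudla1994, Thm 3.1] is trivial on `P_Δ ∩ K_H` at a good place); written for the kernel construction of
[GelbartRogawski1991, Prop. 3.1.1] (stage-1 cell `pub-hodgecm`, seat GR-1, brick L7e of the local skeleton).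

## References

* S. Gelbart, J. Rogawski, *L-functions and Fourier–Jacobi coefficients for the unitary group U(3)*, Invent. Math. 105
  (1991) 445–472, §3.1 [GelbartRogawski1991].
* S. S. Kudla, *Splitting metaplectic covers of dual reductive pairs*, Israel J. Math. 87 (1994) 361–401, Thm 3.1 [Kudla1994].
-/

set_option autoImplicit false

noncomputable section

open NumberField IsDedekindDomain Matrix
open scoped ValuativeRel
open Literature.NumberTheory.Automorphic Literature.NumberTheory.Automorphic.UnitaryGroup

namespace Literature.NumberTheory.GelbartRogawski1991.UnitaryDualPair.LocalSplitting

/-! ## §1 The determinant of a Siegel-shaped block matrix -/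

/-- **column∕row reduction of a Siegel-shaped block matrix**: if the blocks of `M = [[a, b], [c, d]]` satisfy
`a + b = c + d`, then `det M = det (a + b) · det (d − b)`. [cite: Kudla1994, §3 (the Levi factor of `P_Δ`)] -/
theorem det_eq_of_blocks {R : Type*} [CommRing R] {ι : Type*} [Fintype ι] [DecidableEq ι]
    (M : Matrix (ι ⊕ ι) (ι ⊕ ι) R) (hM : M.toBlocks₁₁ + M.toBlocks₁₂ = M.toBlocks₂₁ + M.toBlocks₂₂) :
    M.det = (M.toBlocks₁₁ + M.toBlocks₁₂).det * (M.toBlocks₂₂ - M.toBlocks₁₂).det := by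
  set a := M.toBlocks₁₁
  set b := M.toBlocks₁₂
  set c := M.toBlocks₂₁
  set d := M.toBlocks₂₂
  have hMb : M = Matrix.fromBlocks a b c d := (Matrix.fromBlocks_toBlocks M).symm
  -- the two unipotent factors
  have hL : (Matrix.fromBlocks (1 : Matrix ι ι R) (0 : Matrix ι ι R) (-1 : Matrix ι ι R) (1 : Matrix ι ι R)).det = 1 := by
    rw [Matrix.det_fromBlocks_zero₁₂, Matrix.det_one, mul_one]
  have hU : (Matrix.fromBlocks (1 : Matrix ι ι R) (0 : Matrix ι ι R) (1 : Matrix ι ι R) (1 : Matrix ι ι R)).det = 1 := by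
    rw [Matrix.det_fromBlocks_zero₁₂, Matrix.det_one, mul_one]
  have hprod : Matrix.fromBlocks (1 : Matrix ι ι R) (0 : Matrix ι ι R) (-1 : Matrix ι ι R) (1 : Matrix ι ι R) * M *
        Matrix.fromBlocks (1 : Matrix ι ι R) (0 : Matrix ι ι R) (1 : Matrix ι ι R) (1 : Matrix ι ι R) =
      Matrix.fromBlocks (a + b) b 0 (d - b) := by
    rw [hMb, Matrix.fromBlocks_multiply, Matrix.fromBlocks_multiply]
    have hc : c = a + b - d := by rw [hM]; abel
    rw [hc]
    congr 1 <;> noncomm_ring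
  have hdet := congrArg Matrix.det hprod
  rw [Matrix.det_mul, Matrix.det_mul, hL, hU, one_mul, mul_one, Matrix.det_fromBlocks_zero₂₁] at hdet
  exact hdet

/-! ## §2 `det_Δ p` is a unit at `w` for `p ∈ P_Δ(F_v)` with `p_w ∈ GL_{n+n}(𝒪_w)` -/

variable (F : Type) [Field F] [NumberField F] (E : Type) [Field E] [NumberField E] [Algebra F E]
  [Algebra.IsQuadraticExtension F E] (c : E ≃ₐ[F] E)
  {δ : E} (hcδ : c δ = -δ) (hδ : δ ≠ 0) {d : F} (hd : δ * δ = algebraMap F E d)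
  (v : HeightOneSpectrum (𝓞 F)) (n : ℕ) {T₀ : Matrix (Fin n) (Fin n) F} (hT₀ : T₀.IsSymm) (hT₀d : IsUnit T₀.det)
  {JD : Matrix (Fin (n + n)) (Fin (n + n)) E} (hJD : JD = (gramD F n T₀).map (algebraMap F E))

omit [NumberField F] [Algebra.IsQuadraticExtension F E] in
/-- the determinant of an element of `GL_N(𝒪_w)` is a `w`-unit (it and the determinant of the inverse are integral
with product `1`). [cite: PlatonovRapinchuk1994, §5.1 (the group `G_{𝒪_v}`)] -/
theorem valuation_det_eq_one_of_mem_glInt' (w : PlacesOver E v) {N : ℕ} {g : GL (Fin N) (w.1.adicCompletion E)}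
    (hg : g ∈ glInt N (w.1.adicCompletion E)) :
    ValuativeRel.valuation (w.1.adicCompletion E) (g : Matrix (Fin N) (Fin N) (w.1.adicCompletion E)).det = 1 := by
  obtain ⟨h1, h2⟩ := (mem_glInt_iff g).1 hg
  have hv1 : ValuativeRel.valuation _ (g : Matrix (Fin N) (Fin N) (w.1.adicCompletion E)).det ≤ 1 :=
    valuation_det_le_one fun i j => (Valuation.mem_integer_iff _ _).1 (h1 i j)
  have hv2 : ValuativeRel.valuation _ ((g⁻¹ : GL (Fin N) (w.1.adicCompletion E)) :
      Matrix (Fin N) (Fin N) (w.1.adicCompletion E)).det ≤ 1 :=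
    valuation_det_le_one fun i j => (Valuation.mem_integer_iff _ _).1 (h2 i j)
  have hprod : ValuativeRel.valuation _ (g : Matrix (Fin N) (Fin N) (w.1.adicCompletion E)).det *
      ValuativeRel.valuation _ ((g⁻¹ : GL (Fin N) (w.1.adicCompletion E)) :
        Matrix (Fin N) (Fin N) (w.1.adicCompletion E)).det = 1 := by
    rw [← map_mul, ← Matrix.det_mul, ← Units.val_mul, mul_inv_cancel, Units.val_one, Matrix.det_one, map_one]
  refine le_antisymm hv1 ?_
  calc (1 : ValuativeRel.ValueGroupWithZero (w.1.adicCompletion E))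
      = _ * _ := hprod.symm
    _ ≤ _ * 1 := mul_le_mul' le_rfl hv2
    _ = _ := mul_one _

omit [NumberField F] [Algebra.IsQuadraticExtension F E] in
/-- in an ordered value group: `x ≤ 1`, `y ≤ 1`, `x · y = 1` force `x = 1`. [folklore] -/
private theorem eq_one_of_mul_eq_one_of_le (w : PlacesOver E v)
    {x y : ValuativeRel.ValueGroupWithZero (w.1.adicCompletion E)} (hx : x ≤ 1) (hy : y ≤ 1) (hxy : x * y = 1) :
    x = 1 := by
  refine le_antisymm hx ?_
  calc (1 : ValuativeRel.ValueGroupWithZero (w.1.adicCompletion E)) = x * y := hxy.symm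
    _ ≤ x * 1 := mul_le_mul' le_rfl hy
    _ = x := mul_one _

include hcδ hδ hd hT₀ hJD in
/-- **`det_Δ p ∈ 𝒪_w^×`** for `p ∈ P_Δ(F_v)` whose `w`-component lies in `GL_{n+n}(𝒪_w)`: `det p_w = det_Δ p · det (d − b)`
with integral factors and unit left-hand side. [cite: GelbartRogawski1991, §3.1 (3.1.3); Kudla1994, Thm 3.1] -/
theorem valuation_detDelta_eq_one (w : PlacesOver E v) {p : UnitaryGroup.localPi E c (n + n) JD v}
    (hpw : (p : UnitaryGroup.LocalGLPi E (n + n) v) w ∈ glInt (n + n) (w.1.adicCompletion E))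
    (hpΔ : IsSiegelDelta F E c hcδ hδ hd v n hT₀ hJD p) :
    ValuativeRel.valuation (w.1.adicCompletion E) (detDelta F E c v n w p) = 1 := by
  -- the `e₂`-blocks of `p_w`
  set M : Matrix (Fin n ⊕ Fin n) (Fin n ⊕ Fin n) (w.1.adicCompletion E) :=
    Matrix.reindex (e₂ n).symm (e₂ n).symm
      (((p : UnitaryGroup.LocalGLPi E (n + n) v) w : GL (Fin (n + n)) (w.1.adicCompletion E)) :
        Matrix (Fin (n + n)) (Fin (n + n)) (w.1.adicCompletion E)) with hMdef
  have hblocks : M.toBlocks₁₁ + M.toBlocks₁₂ = M.toBlocks₂₁ + M.toBlocks₂₂ :=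
    (isSiegelDelta_iff_blocks F E c hcδ hδ hd v n hT₀ hJD p).1 hpΔ w
  -- integrality of `M`
  have hMi : ValBound 1 M := by
    intro i j
    simp only [hMdef, Matrix.reindex_apply, Matrix.submatrix_apply]
    exact (Valuation.mem_integer_iff _ _).1 (((mem_glInt_iff _).1 hpw).1 _ _)
  have h11 : ValBound 1 M.toBlocks₁₁ := fun i j => hMi (Sum.inl i) (Sum.inl j)
  have h12 : ValBound 1 M.toBlocks₁₂ := fun i j => hMi (Sum.inl i) (Sum.inr j)
  have h22 : ValBound 1 M.toBlocks₂₂ := fun i j => hMi (Sum.inr i) (Sum.inr j)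
  have hX : ValuativeRel.valuation _ (M.toBlocks₁₁ + M.toBlocks₁₂).det ≤ 1 := valuation_det_le_one (h11.add h12)
  have hY : ValuativeRel.valuation _ (M.toBlocks₂₂ - M.toBlocks₁₂).det ≤ 1 := valuation_det_le_one (h22.sub h12)
  -- `det M = det p_w` is a unit
  have hdetM : ValuativeRel.valuation (w.1.adicCompletion E) M.det = 1 := by
    rw [hMdef, Matrix.det_reindex_self]
    exact valuation_det_eq_one_of_mem_glInt' F E v w hpw
  rw [det_eq_of_blocks M hblocks, map_mul] at hdetM
  -- `det_Δ p = det (M₁₁ + M₁₂)` by definition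
  have hdef : detDelta F E c v n w p = (M.toBlocks₁₁ + M.toBlocks₁₂).det := rfl
  rw [hdef]
  exact eq_one_of_mul_eq_one_of_le F E v w hX hY hdetM

include hcδ hδ hd hT₀ hJD in
/-- `det_Δ p` is a unit (nonzero) for such `p`. [cite: Kudla1994, Thm 3.1] -/
theorem isUnit_detDelta_of_mem_glInt (w : PlacesOver E v) {p : UnitaryGroup.localPi E c (n + n) JD v}
    (hpw : (p : UnitaryGroup.LocalGLPi E (n + n) v) w ∈ glInt (n + n) (w.1.adicCompletion E))
    (hpΔ : IsSiegelDelta F E c hcδ hδ hd v n hT₀ hJD p) : IsUnit (detDelta F E c v n w p) := by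
  have h := valuation_detDelta_eq_one F E c hcδ hδ hd v n hT₀ hJD w hpw hpΔ
  refine isUnit_iff_ne_zero.2 fun h0 => ?_
  rw [h0, map_zero] at h
  exact zero_ne_one h

/-! ## §3 `χ_v(det_Δ p) = 1` for unramified `χ_v` -/

include hcδ hδ hd hT₀ hJD in
/-- **`χ_v(det_Δ p) = 1` on `P_Δ(F_v) ∩ H(𝒪_v)`** for a family of UNRAMIFIED characters `χ_w` (`χ_w(u) = 1` whenever
`|u|_w = 1`), at any finite place `v`. [cite: GelbartRogawski1991, §3.1 (3.1.2)–(3.1.3); Kudla1994, Thm 3.1] -/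
theorem chiDet_eq_one_of_mem_localInt (χv : ∀ w : PlacesOver E v, (w.1.adicCompletion E)ˣ →* ℂˣ)
    (hχ : ∀ (w : PlacesOver E v) (u : (w.1.adicCompletion E)ˣ),
      ValuativeRel.valuation (w.1.adicCompletion E) (u : w.1.adicCompletion E) = 1 → χv w u = 1)
    {p : UnitaryGroup.localPi E c (n + n) JD v} (hp : p ∈ UnitaryGroup.localInt E c (n + n) JD v)
    (hpΔ : IsSiegelDelta F E c hcδ hδ hd v n hT₀ hJD p) : chiDet F E c v n χv p = 1 := by
  unfold chiDet
  refine Finset.prod_eq_one fun w _ => ?_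
  split_ifs with hu
  · refine hχ w hu.unit ?_
    rw [IsUnit.unit_spec]
    exact valuation_detDelta_eq_one F E c hcδ hδ hd v n hT₀ hJD w ((mem_localInt_iff E c (n + n) JD v p).1 hp w) hpΔ
  · rfl

omit [NumberField F] [Algebra.IsQuadraticExtension F E] in
include hcδ hδ in
/-- `c ≠ 1` (since `c δ = −δ` with `δ ≠ 0`). [cite: CasselsFrohlichANT1967, Ch. VII Prop. 1.2] -/
theorem galConj_ne_one_of_delta : c ≠ 1 := by
  intro h1; apply hδ
  have h2 : (2 : E) * δ = 0 := by
    have : δ = -δ := by simpa [h1] using hcδ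
    linear_combination this
  exact (mul_eq_zero.1 h2).resolve_left two_ne_zero

include hcδ hδ hd hT₀ hJD in
/-- **non-split form**: at a non-split place (`c • w = w`, so `w` is the only place over `v`) it suffices that the
one character `χ_w` be unramified. This is the shape consumed by the unramified clause of the local skeleton (L7e).
[cite: GelbartRogawski1991, §3.1 (3.1.3); Kudla1994, Thm 3.1] -/
theorem chiDet_eq_one_of_mem_localInt_of_smul_eq (w : PlacesOver E v) (hw : c • w.1 = w.1)
    (χv : ∀ w : PlacesOver E v, (w.1.adicCompletion E)ˣ →* ℂˣ)
    (hχ : ∀ u : (w.1.adicCompletion E)ˣ,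
      ValuativeRel.valuation (w.1.adicCompletion E) (u : w.1.adicCompletion E) = 1 → χv w u = 1)
    {p : UnitaryGroup.localPi E c (n + n) JD v} (hp : p ∈ UnitaryGroup.localInt E c (n + n) JD v)
    (hpΔ : IsSiegelDelta F E c hcδ hδ hd v n hT₀ hJD p) : chiDet F E c v n χv p = 1 := by
  refine chiDet_eq_one_of_mem_localInt F E c hcδ hδ hd v n hT₀ hJD χv (fun w' u hu => ?_) hp hpΔ
  obtain rfl : w' = w := PlacesOver.eq_of_smul_eq c (galConj_ne_one_of_delta F E c hcδ hδ) w hw w'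
  exact hχ u hu

/-! ### Build-lane note (ops-buildfix G11b-3 recipe, LEDGER B13-1, 2026-08-21)
`lean -o` (the hub build lane, never `lean`/the gate check) runs Lean 4.32's library-suggestion indexers
(`Lean.LibrarySuggestions.SymbolFrequency` / `SineQuaNon`, from their `exportEntriesFn`) over the statement of
every local theorem that is not a denied premise; on this family's statements (very large dependent binder
telescopes through the theta-kernel / dual-pair data) that fold runs for tens of minutes to hours and the build
lane kills the job (incident G11b-3, run/shared/lean/ops/buildfix/G11b-3-DOSSIER.md). `isDeniedPremise` skips
`[implicit_reducible]` constants before any fold, and a reducibility status on a *theorem* is inert (Meta never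
unfolds `thmInfo`; the kernel ignores the attribute), so the public theorems of this file are tagged
`[implicit_reducible]` purely to keep them out of that index. Only other effect: they are not offered by
`+suggestions` premise selectors. No statement or proof is changed; superseded if the operator lands a
deny-list form (`HarnessLib.PremiseIndex`). -/
set_option allowUnsafeReducibility true in
attribute [implicit_reducible]
  det_eq_of_blocks valuation_det_eq_one_of_mem_glInt' valuation_detDelta_eq_one
  isUnit_detDelta_of_mem_glInt chiDet_eq_one_of_mem_localInt galConj_ne_one_of_delta
  chiDet_eq_one_of_mem_localInt_of_smul_eq

end Literature.NumberTheory.GelbartRogawski1991.UnitaryDualPair.LocalSplitting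

end
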